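import Summits.BirchSwinnertonDyer.Rank1Residual.GaloisImage.KuriharaRecordCorollaryThree
import Summits.BirchSwinnertonDyer.Rank1Residual.Additive.X4RankZeroKuriharaWitness
import Summits.BirchSwinnertonDyer.Rank1Residual.Additive.X4ThreeResCertKernel
import Summits.BirchSwinnertonDyer.Rank1Residual.Additive.X4RankZeroKuriharaWitnessNoLemma20
import Literature.NumberTheory.EllipticCurves.AtkinLehnerFrickeLevelProofs
import HarnessLib

/-!
# `BSD(E,3)` on class A1 from ONE Kurihara certificate — the RECORD-READY END COROLLARIES of
# sub-route (a′) through additive-p4's LOWER-half sockets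
# (cell `b2b-bsdres`, team n1011, ROUTE-1 R1-45 (e); row T-R1-45 FILE E2; seat p18)

HONEST FRAMING (cell `b2b-bsdres`, run/shared/lean/b2b/bsd-rank1-residual/, verbatim in every
file): the goal of the cell is to DELETE the COMBINATION-SHAPED residual classes of the
Birch–Swinnerton-Dyer formula for ALL analytic-rank `≤ 1` elliptic curves over `ℚ` — "full BSD
formula for every rank `≤ 1` curve in class `C`" assembled STRICTLY from published theorems — so
that the rank-`≤ 1` remainder becomes exactly the CONSTRUCTION-SHAPED classes, which are TYPED
(missing-input `Prop`s), NOT attempted. This is not "finishing BSD". Team n1011 (N10/N11, the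
additive block `X4 ∧ p = 3`): research route; PER-PAIR record shape, NOT a class theorem; TOOL
theorems only (no definition, no named fact); nothing booked; no mark / label moved.  CONDITIONAL
on: the named facts `hS24`/`hS24₂` ([S24] Thm. 4.4 (1)(2)), the Poitou–Tate families, Tate's
`hEP`, ONE typed PORT hypothesis `KatoKuriharaPortThreeAt W 0 v₃` (FLAG `K22-Thm3.13-PORT@3`, the
DICT3 debt line), and — for the UPPER half of `BSD(E,3)` — the five named facts of the X4 chain of
record (`hKatoS hDel hmodD hL20 hKatoχ`) with `hGZK`, `hmod`, `h26` [+ `hCT` on the defect-one rows],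
exactly as `Additive/X4ThreeResCertKernel.lean` / `Additive/X4RankZeroKuriharaWitness.lean`.  The
certificate lines are per-record EVIDENCE decided in the kernel on numerals.

## What and why

`Assembly.exists_LOmega_padicValRat_le_of_towerSurj` (file E1, `KuriharaRecordCorollaryThree.lean`)
is Kurihara's LOWER half `∃ q, L(E,1)/Ω(W) = q ∧ ord₃ q ≤ ord₃ #Ш(E)(3)` on class A1 from the
`3`-adic tower, [S24] (1)(2), PT, `hEP`, the port and ONE certificate.  additive-p4's sockets
(`Additive/X4RankZeroKuriharaWitness.lean`, p249363) turn exactly this output shape into `BSD(E,p)`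
with the UPPER half from the X4 chain of record.  Composed here, in the record shape of
`Additive/X4ThreeKuriharaCertKernel.lean` (integer model `E₀`, tower record, optimal datum):

* `Assembly.bsdp_three_of_towerSurj_of_kolyvaginProduct` — potentially GOOD, `3 ∤ ∏ c_ℓ` (the
  unit-Tamagawa LOWER@3 window rows), socket `X4RankZero.bsdp_three_of_towerSurj_of_optimal_of_LOmegaWitness`;
* `Assembly.bsdp_three_potMult_of_towerSurj_of_kolyvaginProduct` — `ord₃ j < 0`, socket
  `X4RankZero.bsdp_three_potMult_of_LOmegaWitness`;
* `Assembly.bsdp_three_of_towerSurj_of_kolyvaginProduct_of_even` — Tamagawa defect ONE with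
  `ord₃ #Ш_an` even, socket `X4RankZero.bsdp_three_of_towerSurj_of_optimal_of_LOmegaWitness_of_even`.

What this REPLACES in the 66 kernel records of row T-a2-REC (`Additive/X4ThreeKuriharaCertRecordsS2_*`):
the ANNOUNCED [K25] input `hK25s` (flag `Kim2025-preprint`) by published-at-3 inputs + the ONE port;
what it does NOT do: discharge the port, the PT families, `hEP` or the UPPER-half facts; close any
class; move any mark.

References: C.-H. Kim, AJM 148 (2026) Thm. 1.9 (6) [Kim2022StructureSelmer]; R. Sakamoto, JTNB 36
(2024) Thm. 4.4 [Sakamoto2024]; K. Kato, Astérisque 295 (2004) Thm. 14.5 (3), Prop. 14.16 (2)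
[Kato2004Asterisque]; D. Delbourgo (1998) Prop. 4 [Delbourgo1998]; C. Wuthrich (2014) Lemma 20
[Wuthrich2014]; A. Agashe, K. Ribet, W. Stein (2006) Thm. 2.6 [AgasheRibetStein2006]; R. L. Miller,
LMS JCM 14 (2011) Def. 1.1 [Miller2011LMS].
-/

noncomputable section

open scoped Classical NumberField ContRepresentation
open Function Field NumberField IsDedekindDomain IsDedekindDomain.HeightOneSpectrum WeierstrassCurve
  CongruenceSubgroup
  Literature.NumberTheory.EllipticCurves Literature.NumberTheory.EllipticCurves.ModularForms
  Literature.NumberTheory.EllipticCurves.Rank1Residual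
  Literature.NumberTheory.EllipticCurves.AgasheRibetStein2006
  Literature.NumberTheory.GaloisRepresentations
  Literature.NumberTheory.GaloisRepresentations.DiscreteGaloisModule Literature.NumberTheory.GaloisCohomology
  Rat.HeightOneSpectrum
  Summit.BirchSwinnertonDyer.Rank1Residual.Additive Summit.BirchSwinnertonDyer.Rank1Residual.X4

namespace Summit.BirchSwinnertonDyer.Rank1Residual.GaloisImage.Assembly

/-- **`BSD(E,3)` on class A1, potentially GOOD, `3 ∤ ∏ c_ℓ` (the unit-Tamagawa LOWER@3 rows), from
ONE Kurihara certificate** — RECORD-READY.  Globally minimal elliptic `W/ℚ` with integer model `E₀`,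
`3 ∣ Δ(E₀)`, `3 ∣ c₄(E₀)` (ADDITIVE at `3`), the `3`-adic tower, `E(ℚ₃)[3] = 0`, `r_an = 0`,
`3 ∤ ∏ c_ℓ`, an OPTIMAL datum `D` at `N ≤ 130000`; the named facts of the X4 chain of record for the
UPPER half (`hKatoS hDel hmodD hL20 hKatoχ`, GZK, modularity, `h26`); for the LOWER half the named
facts `hS24`/`hS24₂`, the Poitou–Tate families, Tate's `hEP`, ONE port `KatoKuriharaPortThreeAt W 0 v₃`
(FLAG `K22-Thm3.13-PORT@3`) and the CERTIFICATE (`n ∈ 𝒩₁`, cyclicity at its primes, `ℓ ∤ N`,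
surjective `ψ`, `δ̃_n(ψ) ≢ 0 (mod 3)`, `δ̃_d(ψ) = 0` at `1 < d < n`) ⟹ **`BSD(E,3)`**.  The output
shape of `exists_LOmega_padicValRat_le_of_towerSurj` fed into additive-p4's socket
`X4RankZero.bsdp_three_of_towerSurj_of_optimal_of_LOmegaWitness`.  Per pair; NOT a class theorem;
nothing booked; no mark moved. [cite: Kim2022StructureSelmer, Thm. 1.9 (6)]
[cite: Sakamoto2024, Thm. 4.4 (p. 926)] [cite: Kato2004Asterisque, Thm. 14.5 (3) (p. 236)]
[cite: AgasheRibetStein2006, Thm. 2.6 (p. 619)] [cite: Miller2011LMS, §1 and Def. 1.1] -/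
theorem bsdp_three_of_towerSurj_of_kolyvaginProduct
    (hKatoS : Kato2004.rankZero_padicValNat_sha_le_sub_localTamagawa_of_additive_potGood_of_imageContainsSL2)
    (hDel : Delbourgo1998.prop4_rankZero_pow_dvd_constantCoeff)
    (hGZK : rank_eq_analyticRank_of_analyticRank_le_one) (hmod : hasEntireLFunction_rat)
    (hmodD : nonempty_modularParametrizationData)
    (hL20 : Wuthrich2014.lemma20_surjective_threeAdic_of_semistable)
    (hKatoχ : Wuthrich2014.kato_halfEigenCharIdeal_dvd_cyclotomicPrime_of_surjective)
    (h26 : cremona_abs_maninConstant_eq_one_of_level_le)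
    (hS24 : Sakamoto2024.kolyvaginSystems_freeRankOne_zmod_three_pow)
    (hS24₂ : Sakamoto2024.kolyvaginSystems_idealOfBasis_eq_fittingIdeal_zmod_three_pow)
    (W : WeierstrassCurve ℚ) [W.IsElliptic] [W.IsGloballyMinimal]
    {E₀ : WeierstrassCurve ℤ} (hI : integralModelInt W = E₀)
    (hΔ : (3 : ℤ) ∣ E₀.Δ) (hc₄ : (3 : ℤ) ∣ E₀.c₄)
    (htower : ∀ m : ℕ, W.HasSurjectiveModNGaloisRep (3 ^ m : ℕ))
    (ht0 : Nat.card {Q : (W.baseChange ℚ_[3]).toAffine.Point // (3 : ℕ) • Q = 0} = 1)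
    (hr : W.analyticRank = 0) (htam : ¬ 3 ∣ W.tamagawaProduct)
    {N : ℕ} [NeZero N] (hN : N ≤ 130000) (D : ModularParametrizationData W N)
    (hopt : ∀ z ∈ D.L.lattice, ∃ w ∈ periodLattice D.f, z = D.c * w)
    (inv : LocalInvariants ℚ 3) (hperf : inv.IsPerfect) (hsum : inv.SumLocalTermEqZero)
    (hcompl : inv.SelmerComplement)
    (inv' : ∀ k' : ℕ, LocalInvariants ℚ (3 ^ (k' + 1))) (hperf' : ∀ k', (inv' k').IsPerfect)
    (hsum' : ∀ k', (inv' k').SumLocalTermEqZero) (hcompl' : ∀ k', (inv' k').SelmerComplement)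
    (hinj' : ∀ k', ∀ v : HeightOneSpectrum (𝓞 ℚ), Injective (inv' k' (Sum.inr v)))
    (hEP : ∀ v : HeightOneSpectrum (𝓞 ℚ), localEulerPoincareCharacteristic (v.adicCompletion ℚ))
    (v₃ : HeightOneSpectrum (𝓞 ℚ)) (hv₃ : ((3 : ℕ) : 𝓞 ℚ) ∈ v₃.asIdeal)
    (hPort : KatoKuriharaPortThreeAt W 0 v₃)
    (n : ℕ) [NeZero n] (hn : Kato.IsKolyvaginProduct W 3 1 n)
    (hcyc : ∀ (ℓ : ℕ) [Fact ℓ.Prime], ℓ ∣ n →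
      Nat.card {P : ((integralModelInt W).map (Int.castRingHom (ZMod ℓ))).toAffine.Point //
        3 • P = 0} ≤ 3)
    (hnN : ∀ ℓ ∈ n.primeFactors, ¬ ℓ ∣ N)
    (ψ : (ℓ : ℕ) → (ZMod ℓ)ˣ →* Multiplicative (ZMod (3 ^ 1)))
    (hψ : ∀ ℓ ∈ n.primeFactors, Function.Surjective (ψ ℓ))
    (hcert : kuriharaNumber D.f (3 ^ 1) n ψ ≠ 0)
    (hv : ∀ d : ℕ, d ∣ n → 1 < d → d < n → ∀ [NeZero d], kuriharaNumber D.f (3 ^ 1) d ψ = 0) :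
    BSDp W 3 := by
  haveI : Fact (Nat.Prime 3) := ⟨Nat.prime_three⟩
  have hadd : Addv W 3 := addv_of_intModel hI 3 (by exact_mod_cast hΔ) (by exact_mod_cast hc₄)
  have hc3 : ¬ 3 ∣ (W.baseChange ℚ_[3]).localTamagawaNumber ℤ_[3] := fun h =>
    htam (h.trans (localTamagawaNumber_padic_dvd_tamagawaProduct W 3))
  have hsurj : W.HasSurjectiveModNGaloisRep 3 := by simpa using htower 1
  obtain ⟨q₀, hq₀, hw⟩ := exists_LOmega_padicValRat_le_of_towerSurj hS24 hS24₂ hGZK hmod h26 W hadd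
    hc3 htower ht0 hr hN D hopt inv hperf hsum hcompl inv' hperf' hsum' hcompl' hinj' hEP v₃ hv₃ hPort
    n hn hcyc hnN ψ hψ hcert hv
  exact X4RankZero.bsdp_three_of_towerSurj_of_optimal_of_LOmegaWitness W hKatoS hDel hGZK hmod hmodD
    hL20 hKatoχ h26 hadd hsurj htower hr htam hN ⟨D, hopt⟩ hq₀ hw

/-- **`BSD(E,3)` on class A1, potentially MULTIPLICATIVE (`ord₃ j < 0`), from ONE Kurihara
certificate** — the (M) branch: the output shape fed into additive-p4's
`X4RankZero.bsdp_three_potMult_of_LOmegaWitness` (no Tamagawa / Manin binder on the upper half; the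
lower half still uses the optimal datum for the period transfer and `3 ∤ c₃`).  Per pair; nothing
booked. [cite: Kim2022StructureSelmer, Thm. 1.9 (6)] [cite: Delbourgo1998, Prop. 4 (p. 144)]
[cite: Wuthrich2014, Lemma 20 (p. 399)] [cite: Miller2011LMS, §1 and Def. 1.1] -/
theorem bsdp_three_potMult_of_towerSurj_of_kolyvaginProduct
    (hKatoS : Kato2004.rankZero_padicValNat_sha_le_sub_localTamagawa_of_additive_potGood_of_imageContainsSL2)
    (hDel : Delbourgo1998.prop4_rankZero_pow_dvd_constantCoeff)
    (hGZK : rank_eq_analyticRank_of_analyticRank_le_one) (hmod : hasEntireLFunction_rat)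
    (hmodD : nonempty_modularParametrizationData)
    (hL20 : Wuthrich2014.lemma20_surjective_threeAdic_of_semistable)
    (hKatoχ : Wuthrich2014.kato_halfEigenCharIdeal_dvd_cyclotomicPrime_of_surjective)
    (h26 : cremona_abs_maninConstant_eq_one_of_level_le)
    (hS24 : Sakamoto2024.kolyvaginSystems_freeRankOne_zmod_three_pow)
    (hS24₂ : Sakamoto2024.kolyvaginSystems_idealOfBasis_eq_fittingIdeal_zmod_three_pow)
    (W : WeierstrassCurve ℚ) [W.IsElliptic] [W.IsGloballyMinimal]
    {E₀ : WeierstrassCurve ℤ} (hI : integralModelInt W = E₀)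
    (hΔ : (3 : ℤ) ∣ E₀.Δ) (hc₄ : (3 : ℤ) ∣ E₀.c₄)
    (htower : ∀ m : ℕ, W.HasSurjectiveModNGaloisRep (3 ^ m : ℕ))
    (ht0 : Nat.card {Q : (W.baseChange ℚ_[3]).toAffine.Point // (3 : ℕ) • Q = 0} = 1)
    (hr : W.analyticRank = 0) (hjneg : padicValRat 3 W.j < 0)
    (hc3 : ¬ 3 ∣ (W.baseChange ℚ_[3]).localTamagawaNumber ℤ_[3])
    {N : ℕ} [NeZero N] (hN : N ≤ 130000) (D : ModularParametrizationData W N)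
    (hopt : ∀ z ∈ D.L.lattice, ∃ w ∈ periodLattice D.f, z = D.c * w)
    (inv : LocalInvariants ℚ 3) (hperf : inv.IsPerfect) (hsum : inv.SumLocalTermEqZero)
    (hcompl : inv.SelmerComplement)
    (inv' : ∀ k' : ℕ, LocalInvariants ℚ (3 ^ (k' + 1))) (hperf' : ∀ k', (inv' k').IsPerfect)
    (hsum' : ∀ k', (inv' k').SumLocalTermEqZero) (hcompl' : ∀ k', (inv' k').SelmerComplement)
    (hinj' : ∀ k', ∀ v : HeightOneSpectrum (𝓞 ℚ), Injective (inv' k' (Sum.inr v)))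
    (hEP : ∀ v : HeightOneSpectrum (𝓞 ℚ), localEulerPoincareCharacteristic (v.adicCompletion ℚ))
    (v₃ : HeightOneSpectrum (𝓞 ℚ)) (hv₃ : ((3 : ℕ) : 𝓞 ℚ) ∈ v₃.asIdeal)
    (hPort : KatoKuriharaPortThreeAt W 0 v₃)
    (n : ℕ) [NeZero n] (hn : Kato.IsKolyvaginProduct W 3 1 n)
    (hcyc : ∀ (ℓ : ℕ) [Fact ℓ.Prime], ℓ ∣ n →
      Nat.card {P : ((integralModelInt W).map (Int.castRingHom (ZMod ℓ))).toAffine.Point //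
        3 • P = 0} ≤ 3)
    (hnN : ∀ ℓ ∈ n.primeFactors, ¬ ℓ ∣ N)
    (ψ : (ℓ : ℕ) → (ZMod ℓ)ˣ →* Multiplicative (ZMod (3 ^ 1)))
    (hψ : ∀ ℓ ∈ n.primeFactors, Function.Surjective (ψ ℓ))
    (hcert : kuriharaNumber D.f (3 ^ 1) n ψ ≠ 0)
    (hv : ∀ d : ℕ, d ∣ n → 1 < d → d < n → ∀ [NeZero d], kuriharaNumber D.f (3 ^ 1) d ψ = 0) :
    BSDp W 3 := by
  haveI : Fact (Nat.Prime 3) := ⟨Nat.prime_three⟩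
  have hadd : Addv W 3 := addv_of_intModel hI 3 (by exact_mod_cast hΔ) (by exact_mod_cast hc₄)
  have hsurj : W.HasSurjectiveModNGaloisRep 3 := by simpa using htower 1
  have hX : ClassX4 W 3 :=
    ⟨by norm_num, hadd, hasIrreducibleModPGaloisRep_of_hasSurjectiveModNGaloisRep W 3 hsurj⟩
  obtain ⟨q₀, hq₀, hw⟩ := exists_LOmega_padicValRat_le_of_towerSurj hS24 hS24₂ hGZK hmod h26 W hadd
    hc3 htower ht0 hr hN D hopt inv hperf hsum hcompl inv' hperf' hsum' hcompl' hinj' hEP v₃ hv₃ hPort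
    n hn hcyc hnN ψ hψ hcert hv
  exact X4RankZero.bsdp_three_potMult_of_LOmegaWitness W hKatoS hDel hGZK hmod hmodD hL20 hKatoχ hr hX
    hsurj hjneg hq₀ (j := 0) (Nat.zero_le _) (by simpa using hw)

/-- **`BSD(E,3)` on class A1, potentially GOOD, Tamagawa defect ONE (`ord₃ ∏ c_ℓ ≤ ord₃ c₃ + 1`,
`ord₃ #Ш_an` even), from ONE Kurihara certificate** — the parity socket: the output shape fed into
additive-p4's `X4RankZero.bsdp_three_of_towerSurj_of_optimal_of_LOmegaWitness_of_even` (sharp Kato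
+ Cassels–Tate + `ord₃ #Ш_an` even).  Per pair; nothing booked.
[cite: Kim2022StructureSelmer, Thm. 1.9 (6)] [cite: Kato2004Asterisque, Thm. 14.5 (3) (p. 236), Prop. 14.16 (2) (p. 244)]
[cite: AgasheRibetStein2006, Thm. 2.6 (p. 619)] [cite: Miller2011LMS, §1 and Def. 1.1] -/
theorem bsdp_three_of_towerSurj_of_kolyvaginProduct_of_even
    (hCT : exists_casselsTate_pairing (K := ℚ))
    (hKatoS : Kato2004.rankZero_padicValNat_sha_le_sub_localTamagawa_of_additive_potGood_of_imageContainsSL2)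
    (hGZK : rank_eq_analyticRank_of_analyticRank_le_one) (hmod : hasEntireLFunction_rat)
    (h26 : cremona_abs_maninConstant_eq_one_of_level_le)
    (hS24 : Sakamoto2024.kolyvaginSystems_freeRankOne_zmod_three_pow)
    (hS24₂ : Sakamoto2024.kolyvaginSystems_idealOfBasis_eq_fittingIdeal_zmod_three_pow)
    (W : WeierstrassCurve ℚ) [W.IsElliptic] [W.IsGloballyMinimal]
    {E₀ : WeierstrassCurve ℤ} (hI : integralModelInt W = E₀)
    (hΔ : (3 : ℤ) ∣ E₀.Δ) (hc₄ : (3 : ℤ) ∣ E₀.c₄)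
    (htower : ∀ m : ℕ, W.HasSurjectiveModNGaloisRep (3 ^ m : ℕ))
    (ht0 : Nat.card {Q : (W.baseChange ℚ_[3]).toAffine.Point // (3 : ℕ) • Q = 0} = 1)
    (hr : W.analyticRank = 0) (hpot : 0 ≤ padicValRat 3 W.j)
    (hc3 : ¬ 3 ∣ (W.baseChange ℚ_[3]).localTamagawaNumber ℤ_[3])
    (hdef : haveI : Fact (Nat.Prime 3) := ⟨Nat.prime_three⟩;
      padicValNat 3 W.tamagawaProduct ≤
        padicValNat 3 ((W.baseChange ℚ_[3]).localTamagawaNumber ℤ_[3]) + 1)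
    {q : ℚ} (hq : shaAn W = (q : ℂ)) (heven : Even (padicValRat 3 q))
    {N : ℕ} [NeZero N] (hN : N ≤ 130000) (D : ModularParametrizationData W N)
    (hopt : ∀ z ∈ D.L.lattice, ∃ w ∈ periodLattice D.f, z = D.c * w)
    (inv : LocalInvariants ℚ 3) (hperf : inv.IsPerfect) (hsum : inv.SumLocalTermEqZero)
    (hcompl : inv.SelmerComplement)
    (inv' : ∀ k' : ℕ, LocalInvariants ℚ (3 ^ (k' + 1))) (hperf' : ∀ k', (inv' k').IsPerfect)
    (hsum' : ∀ k', (inv' k').SumLocalTermEqZero) (hcompl' : ∀ k', (inv' k').SelmerComplement)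
    (hinj' : ∀ k', ∀ v : HeightOneSpectrum (𝓞 ℚ), Injective (inv' k' (Sum.inr v)))
    (hEP : ∀ v : HeightOneSpectrum (𝓞 ℚ), localEulerPoincareCharacteristic (v.adicCompletion ℚ))
    (v₃ : HeightOneSpectrum (𝓞 ℚ)) (hv₃ : ((3 : ℕ) : 𝓞 ℚ) ∈ v₃.asIdeal)
    (hPort : KatoKuriharaPortThreeAt W 0 v₃)
    (n : ℕ) [NeZero n] (hn : Kato.IsKolyvaginProduct W 3 1 n)
    (hcyc : ∀ (ℓ : ℕ) [Fact ℓ.Prime], ℓ ∣ n →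
      Nat.card {P : ((integralModelInt W).map (Int.castRingHom (ZMod ℓ))).toAffine.Point //
        3 • P = 0} ≤ 3)
    (hnN : ∀ ℓ ∈ n.primeFactors, ¬ ℓ ∣ N)
    (ψ : (ℓ : ℕ) → (ZMod ℓ)ˣ →* Multiplicative (ZMod (3 ^ 1)))
    (hψ : ∀ ℓ ∈ n.primeFactors, Function.Surjective (ψ ℓ))
    (hcert : kuriharaNumber D.f (3 ^ 1) n ψ ≠ 0)
    (hv : ∀ d : ℕ, d ∣ n → 1 < d → d < n → ∀ [NeZero d], kuriharaNumber D.f (3 ^ 1) d ψ = 0) :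
    BSDp W 3 := by
  haveI : Fact (Nat.Prime 3) := ⟨Nat.prime_three⟩
  have hadd : Addv W 3 := addv_of_intModel hI 3 (by exact_mod_cast hΔ) (by exact_mod_cast hc₄)
  have hsurj : W.HasSurjectiveModNGaloisRep 3 := by simpa using htower 1
  obtain ⟨q₀, hq₀, hw⟩ := exists_LOmega_padicValRat_le_of_towerSurj hS24 hS24₂ hGZK hmod h26 W hadd
    hc3 htower ht0 hr hN D hopt inv hperf hsum hcompl inv' hperf' hsum' hcompl' hinj' hEP v₃ hv₃ hPort
    n hn hcyc hnN ψ hψ hcert hv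
  exact X4RankZero.bsdp_three_of_towerSurj_of_optimal_of_LOmegaWitness_of_even W hCT hKatoS hGZK hmod
    h26 hadd hsurj htower hr hpot hN ⟨D, hopt⟩ hdef hq heven hq₀ (j := 0) (Nat.zero_le _)
    (by simpa using hw)


/-- **`BSD(E,3)` from a PAIR certificate, sub-levels by parity — the record-ready END COROLLARY of
route planner 1's R1-45 under its working name.**  Same as `bsdp_three_of_towerSurj_of_kolyvaginProduct`
(class A1, potentially GOOD, `3 ∤ ∏ c_ℓ`) for `n` with exactly two prime factors, the vanishing of the
two single-prime Kurihara numbers being DISCHARGED by additive-p4's parity theorem from the level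
identity `N_E = N` and the rank-`0` Fricke sign `w_N f = −f` (`exists_LOmega_padicValRat_le_of_towerSurj_of_pair`).
Per pair; NOT a class theorem; nothing booked; no mark moved.
[cite: Kim2022StructureSelmer, Thm. 1.9 (6)] [cite: MazurTateTeitelbaum1986Invent, §I.17 and §I.4 (4.2)]
[cite: Kato2004Asterisque, Thm. 14.5 (3) (p. 236)] [cite: AgasheRibetStein2006, Thm. 2.6 (p. 619)]
[cite: Miller2011LMS, §1 and Def. 1.1] -/
theorem bsdp_three_of_towerSurj_of_pairCertificate
    (hKatoS : Kato2004.rankZero_padicValNat_sha_le_sub_localTamagawa_of_additive_potGood_of_imageContainsSL2)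
    (hDel : Delbourgo1998.prop4_rankZero_pow_dvd_constantCoeff)
    (hGZK : rank_eq_analyticRank_of_analyticRank_le_one) (hmod : hasEntireLFunction_rat)
    (hmodD : nonempty_modularParametrizationData)
    (hL20 : Wuthrich2014.lemma20_surjective_threeAdic_of_semistable)
    (hKatoχ : Wuthrich2014.kato_halfEigenCharIdeal_dvd_cyclotomicPrime_of_surjective)
    (h26 : cremona_abs_maninConstant_eq_one_of_level_le)
    (hS24 : Sakamoto2024.kolyvaginSystems_freeRankOne_zmod_three_pow)
    (hS24₂ : Sakamoto2024.kolyvaginSystems_idealOfBasis_eq_fittingIdeal_zmod_three_pow)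
    (W : WeierstrassCurve ℚ) [W.IsElliptic] [W.IsGloballyMinimal]
    {E₀ : WeierstrassCurve ℤ} (hI : integralModelInt W = E₀)
    (hΔ : (3 : ℤ) ∣ E₀.Δ) (hc₄ : (3 : ℤ) ∣ E₀.c₄)
    (htower : ∀ m : ℕ, W.HasSurjectiveModNGaloisRep (3 ^ m : ℕ))
    (ht0 : Nat.card {Q : (W.baseChange ℚ_[3]).toAffine.Point // (3 : ℕ) • Q = 0} = 1)
    (hr : W.analyticRank = 0) (htam : ¬ 3 ∣ W.tamagawaProduct)
    {N : ℕ} [NeZero N] (hN : N ≤ 130000) (D : ModularParametrizationData W N)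
    (hopt : ∀ z ∈ D.L.lattice, ∃ w ∈ periodLattice D.f, z = D.c * w)
    (hNE : W.conductorNorm ℤ = N) (hε : atkinLehnerInvolution N 2 N D.f = -D.f)
    (inv : LocalInvariants ℚ 3) (hperf : inv.IsPerfect) (hsum : inv.SumLocalTermEqZero)
    (hcompl : inv.SelmerComplement)
    (inv' : ∀ k' : ℕ, LocalInvariants ℚ (3 ^ (k' + 1))) (hperf' : ∀ k', (inv' k').IsPerfect)
    (hsum' : ∀ k', (inv' k').SumLocalTermEqZero) (hcompl' : ∀ k', (inv' k').SelmerComplement)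
    (hinj' : ∀ k', ∀ v : HeightOneSpectrum (𝓞 ℚ), Injective (inv' k' (Sum.inr v)))
    (hEP : ∀ v : HeightOneSpectrum (𝓞 ℚ), localEulerPoincareCharacteristic (v.adicCompletion ℚ))
    (v₃ : HeightOneSpectrum (𝓞 ℚ)) (hv₃ : ((3 : ℕ) : 𝓞 ℚ) ∈ v₃.asIdeal)
    (hPort : KatoKuriharaPortThreeAt W 0 v₃)
    (n : ℕ) [NeZero n] (hn : Kato.IsKolyvaginProduct W 3 1 n) (hn2 : n.primeFactors.card = 2)
    (hcyc : ∀ (ℓ : ℕ) [Fact ℓ.Prime], ℓ ∣ n →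
      Nat.card {P : ((integralModelInt W).map (Int.castRingHom (ZMod ℓ))).toAffine.Point //
        3 • P = 0} ≤ 3)
    (ψ : (ℓ : ℕ) → (ZMod ℓ)ˣ →* Multiplicative (ZMod (3 ^ 1)))
    (hψ : ∀ ℓ ∈ n.primeFactors, Function.Surjective (ψ ℓ))
    (hcert : kuriharaNumber D.f (3 ^ 1) n ψ ≠ 0) :
    BSDp W 3 := by
  haveI : Fact (Nat.Prime 3) := ⟨Nat.prime_three⟩
  have hadd : Addv W 3 := addv_of_intModel hI 3 (by exact_mod_cast hΔ) (by exact_mod_cast hc₄)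
  have hc3 : ¬ 3 ∣ (W.baseChange ℚ_[3]).localTamagawaNumber ℤ_[3] := fun h =>
    htam (h.trans (localTamagawaNumber_padic_dvd_tamagawaProduct W 3))
  have hsurj : W.HasSurjectiveModNGaloisRep 3 := by simpa using htower 1
  obtain ⟨q₀, hq₀, hw⟩ := exists_LOmega_padicValRat_le_of_towerSurj_of_pair hS24 hS24₂ hGZK hmod h26 W
    hadd hc3 htower ht0 hr hN D hopt hNE hε inv hperf hsum hcompl inv' hperf' hsum' hcompl' hinj' hEP v₃
    hv₃ hPort n hn hn2 hcyc ψ hψ hcert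
  exact X4RankZero.bsdp_three_of_towerSurj_of_optimal_of_LOmegaWitness W hKatoS hDel hGZK hmod hmodD
    hL20 hKatoχ h26 hadd hsurj htower hr htam hN ⟨D, hopt⟩ hq₀ hw

/-- **R1-45 pair END with the Fricke sign AND Wuthrich's Lemma 20 DISCHARGED** (GEN 6 append; r1
ROUTE-1 §33.1 (d) "the p18-successor's option"): the same record shape as
`bsdp_three_of_towerSurj_of_pairCertificate` WITHOUT `hε` — the rank-`0` Fricke sign `w_N f = −f` is
n1011-p03's THEOREM T-R1-55 (`atkinLehnerInvolution_level_eq_neg_of_entireLFunction_one_ne_zero`,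
from `L(E,1) ≠ 0` ⟸ `r_an = 0` + modularity) transported along `hNE : W.conductorNorm ℤ = N` — and
WITHOUT `hL20` (Wuthrich 2014 Lemma 20 is the tree theorem `…_holds`; socket
`X4RankZero.bsdp_three_of_towerSurj_of_optimal_of_LOmegaWitness_noL20`).  With T-NCOND
(`Additive/IntModelConductorCertificate`) `hNE` is itself a kernel certificate per record
(`IntModelCond.conductorNorm_<label> W hI`), so a pair record now carries, beyond the named facts,
the port, the PT families and `hEP`, ONLY the row deciders and the VALUE `δ̃_n(ψ) ≢ 0 (mod 3)`.
[cite: Kim2022StructureSelmer, Thm. 1.9 (6)] [cite: AtkinLehner1970, Thm. 3]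
[cite: MazurTateTeitelbaum1986Invent, §I.17 and §I.4 (4.2)] -/
theorem bsdp_three_of_towerSurj_of_pairCertificate_of_conductorNorm
    (hKatoS : Kato2004.rankZero_padicValNat_sha_le_sub_localTamagawa_of_additive_potGood_of_imageContainsSL2)
    (hDel : Delbourgo1998.prop4_rankZero_pow_dvd_constantCoeff)
    (hGZK : rank_eq_analyticRank_of_analyticRank_le_one) (hmod : hasEntireLFunction_rat)
    (hmodD : nonempty_modularParametrizationData)
    (hKatoχ : Wuthrich2014.kato_halfEigenCharIdeal_dvd_cyclotomicPrime_of_surjective)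
    (h26 : cremona_abs_maninConstant_eq_one_of_level_le)
    (hS24 : Sakamoto2024.kolyvaginSystems_freeRankOne_zmod_three_pow)
    (hS24₂ : Sakamoto2024.kolyvaginSystems_idealOfBasis_eq_fittingIdeal_zmod_three_pow)
    (W : WeierstrassCurve ℚ) [W.IsElliptic] [W.IsGloballyMinimal]
    {E₀ : WeierstrassCurve ℤ} (hI : integralModelInt W = E₀)
    (hΔ : (3 : ℤ) ∣ E₀.Δ) (hc₄ : (3 : ℤ) ∣ E₀.c₄)
    (htower : ∀ m : ℕ, W.HasSurjectiveModNGaloisRep (3 ^ m : ℕ))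
    (ht0 : Nat.card {Q : (W.baseChange ℚ_[3]).toAffine.Point // (3 : ℕ) • Q = 0} = 1)
    (hr : W.analyticRank = 0) (htam : ¬ 3 ∣ W.tamagawaProduct)
    {N : ℕ} [NeZero N] (hN : N ≤ 130000) (D : ModularParametrizationData W N)
    (hopt : ∀ z ∈ D.L.lattice, ∃ w ∈ periodLattice D.f, z = D.c * w)
    (hNE : W.conductorNorm ℤ = N)
    (inv : LocalInvariants ℚ 3) (hperf : inv.IsPerfect) (hsum : inv.SumLocalTermEqZero)
    (hcompl : inv.SelmerComplement)
    (inv' : ∀ k' : ℕ, LocalInvariants ℚ (3 ^ (k' + 1))) (hperf' : ∀ k', (inv' k').IsPerfect)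
    (hsum' : ∀ k', (inv' k').SumLocalTermEqZero) (hcompl' : ∀ k', (inv' k').SelmerComplement)
    (hinj' : ∀ k', ∀ v : HeightOneSpectrum (𝓞 ℚ), Injective (inv' k' (Sum.inr v)))
    (hEP : ∀ v : HeightOneSpectrum (𝓞 ℚ), localEulerPoincareCharacteristic (v.adicCompletion ℚ))
    (v₃ : HeightOneSpectrum (𝓞 ℚ)) (hv₃ : ((3 : ℕ) : 𝓞 ℚ) ∈ v₃.asIdeal)
    (hPort : KatoKuriharaPortThreeAt W 0 v₃)
    (n : ℕ) [NeZero n] (hn : Kato.IsKolyvaginProduct W 3 1 n) (hn2 : n.primeFactors.card = 2)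
    (hcyc : ∀ (ℓ : ℕ) [Fact ℓ.Prime], ℓ ∣ n →
      Nat.card {P : ((integralModelInt W).map (Int.castRingHom (ZMod ℓ))).toAffine.Point //
        3 • P = 0} ≤ 3)
    (ψ : (ℓ : ℕ) → (ZMod ℓ)ˣ →* Multiplicative (ZMod (3 ^ 1)))
    (hψ : ∀ ℓ ∈ n.primeFactors, Function.Surjective (ψ ℓ))
    (hcert : kuriharaNumber D.f (3 ^ 1) n ψ ≠ 0) :
    BSDp W 3 := by
  haveI : Fact (Nat.Prime 3) := ⟨Nat.prime_three⟩
  have hadd : Addv W 3 := addv_of_intModel hI 3 (by exact_mod_cast hΔ) (by exact_mod_cast hc₄)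
  have hc3 : ¬ 3 ∣ (W.baseChange ℚ_[3]).localTamagawaNumber ℤ_[3] := fun h =>
    htam (h.trans (localTamagawaNumber_padic_dvd_tamagawaProduct W 3))
  have hsurj : W.HasSurjectiveModNGaloisRep 3 := by simpa using htower 1
  -- the rank-0 Fricke sign, a THEOREM (T-R1-55), transported along `N_E = N`
  have hL : W.entireLFunction 1 ≠ 0 := by
    rw [← W.leadingLCoeff_eq_of_analyticRank_eq_zero hr]
    exact W.leadingLCoeff_ne_zero_holds (hmod W)
  have hε : atkinLehnerInvolution N 2 N D.f = -D.f := by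
    subst hNE
    rw [atkinLehnerInvolution_level_eq_neg_of_entireLFunction_one_ne_zero D.isNewformOf hL,
      neg_one_smul]
  obtain ⟨q₀, hq₀, hw⟩ := exists_LOmega_padicValRat_le_of_towerSurj_of_pair hS24 hS24₂ hGZK hmod h26 W
    hadd hc3 htower ht0 hr hN D hopt hNE hε inv hperf hsum hcompl inv' hperf' hsum' hcompl' hinj' hEP v₃
    hv₃ hPort n hn hn2 hcyc ψ hψ hcert
  exact X4RankZero.bsdp_three_of_towerSurj_of_optimal_of_LOmegaWitness_noL20 W hKatoS hDel hGZK hmod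
    hmodD hKatoχ h26 hadd hsurj htower hr htam hN ⟨D, hopt⟩ hq₀ hw

end Summit.BirchSwinnertonDyer.Rank1Residual.GaloisImage.Assembly

end
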